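import Summits.HodgeConjecture.HodgeConjecture.Theorems.F0P6aImgSection
import HarnessLib
import HarnessLib.Audit.LibrarySuggestionsDenyListCruxes

/-!
# F0_P6a_ImgSection — next ED. = SHIM (K6 L2 column re-home; pen LA2-plan (g5) PLAN «L2 cone RE-HOME» v1.4; ★ parts by LA2-p02 (g5) R4; box LAref-D (g4) first ∕ LA-ref1 (g5) second; TEMPLATE by LA2-p03 (g7), DEAL 6 — the LEAD composes the K6 shim request, not L2)

Every declaration of the tree workfile `Lines/F0_P6a_ImgSection.lean` (tree edition of record, sha16 bfb84779d70f88f8, 943 l., sorry-free, stub-free; 17 declarations = 16 theorems + 1 def-like: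
`at`, `exists_comp_threePiece_inv_of_eq₂`, `imgRowHypΩ_of_imgLine`, `exists_comp_quotIncl_spIOf_of_imgRowκ`, `exists_comp_quotIncl_spGeoOf_of_spIOf`, `himg_of_imgRowκ`, `himg_spGeoOf_of_imgLine`, `exists_layerΩ_hom_of_lift`, `exists_layerΩ_hom_of_imgLine`, `comp_ιR_comp_isoGenericOf_inv_comp_actΩ_eq_one`, …, last head `row_IMG`)
now lives, byte for byte and under the SAME namespace `Summit.HodgeConjecture.HodgeConjecture.Cruxes.HLiu418.F0P6aLineSpecialisation`, in the ★ chain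
★ `Theorems/F0P6aImgSectionKill.lean` (p853115) → ★ `Theorems/F0P6aImgSectionRowUp.lean` (p853123) → ★ `Theorems/F0P6aImgSectionRowAssembled.lean` (p853145) → ★ `Theorems/F0P6aImgSection.lean` (p853154) (LAST part = plain stem; each part imports the previous); this module keeps its name so that its tree importers
(`Lines/F0_P6a_StubRHO1.lean`) and any by-name reader under `open …F0P6aLineSpecialisation` resolve unchanged through the import above.
It declares nothing.  No declaration was cut in the ★ twin (verbatim re-home) ⇒ nothing to alias.
ORDER NOTE: written in ONE request with the rest of the K6 L-cone shims on the LEAD՚s word after (K5-R) BUILT and after EVERY ★ part above is ACCEPTED (NO-CROSS-IMPORT: no environment may hold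
a `Lines/` ORIGINAL of this column together with its ★ twin); an importer smoke that reads «environment already contains …» before that request is BUILT is this order note,
not a defect.  Edition history stays in the line card `Lines/F0_P6a_ImgSection.md` and in git; future changes are ★-side proposals on the `Theorems/` files.
HC_CM is proved only modulo the 7 printed citations (2 remaining named inputs: hLiu418 = stmt-HodgeConjecture-24832, h413 = stmt-HodgeConjecture-24833) until rung 0 closes; count-neutral (0 `sorry`, 0 socket, 0 declarations). -/
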